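import Literature.Computability.Cryptography.LWEModulusSwitchDiscrete
import Literature.Computability.Cryptography.LWERateGuessTest
import Literature.Computability.Cryptography.LWECandidateSelect
import Literature.Computability.Cryptography.LWEDistinguisherTransport
import HarnessLib

/-!
# BLPRS 2013, Cor. 3.2 + Lemma 2.15 + secret re-randomisation: the test on `binLWE` mod `Q` built from a distinguisher mod `q'`

Topic `Computability/Cryptography` (LWE), grouping namespace `BLPRS2013`. Proved glue (no named fact)
towards `Literature.Computability.Cryptography.blprs_gapSVP_sqrt_dim_to_lwe_classical` (**pqc.S21**),
hypothesis `h₃` of `BLPRSReduction.lean` — the three steps between Thm. 4.1's target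
`binLWE_{n,m,Q,≤}` and the given distinguisher `K` of `LWE_{n,q',Ψ̄_α}` (uniform secret, EXACT rate `α`):

> *"combining Theorem 4.1 and Corollary 3.2 … we obtain hardness of `binLWE_{n,m,q',β}` … (Strictly
> speaking, one also needs to apply Lemma 2.15 to replace the 'unknown noise' variant of LWE given by
> Corollary 3.2 with the fixed noise variant.)"* (arXiv:1306.0281, p. 13.)

Row `w` of the rate-guess test (`LWERateGuessTest.lean`) is the kernel `rateGuessKernel w`: a fresh uniform
secret shift `t ← U(ℤ_{q'}ⁿ)` (Regev's random self-reduction, making the secret uniform and independent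
of the binary secret `z`), then the discretised modulus switch of `LWEModulusSwitchDiscrete.lean` with the
noise raising `τ w` (so that for the right guess the switched rate is EXACTLY `α`). Proved here:

* `abs_toReal_acceptProb_switchTest_sub_le` — one-pair advantage transfer through the switch;
* `pacc_bind_rateGuessKernel` — the row acceptance probability is the `t`-average of the fixed-`t` ones;
* **`abs_pacc_rateGuessKernel_uniform_sub_le`** — uniform blocks mod `Q` go to within `4εm₃` of uniform
  blocks mod `q'` in `K`-acceptance (Lemma 3.5 (i));
* `bind_uniform_lweSamples_add` — `E_t A^{m}_{z̄+t,χ} = lweSamplesUniformSecret χ m` (the shift average);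
* **`abs_pacc_rateGuessKernel_lwe_sub_le`** — `A_{z̄,Ψ̄_ρ}`-blocks mod `Q` go to within `m₃(2/(ρQ) + 10ε)` of
  `LWE_{n,q',Ψ̄_{ρ'}}` with UNIFORM secret, `ρ'² = ρ² + r²(‖z‖² + B²) + τ_w²` (Lemma 3.5 (ii) + the average);
* **`advantage_rateGuess_hybridH₀`** — for the flat rate-guess test `A` built from `K` (guesses `τ`,
  `N` batches, `N'` reference runs, threshold `θ` with `4θ ≤ Adv[K]`): if every secret `z` in the support
  of `ζ` has `‖z‖ ≤ B`, a rate `ρ₀(z̄) ≥ α₀` and a guess `w` with `ρ₀(z̄)² + r²(‖z‖² + B²) + τ_w² = α²`, and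
  `4εm₃ ≤ θ/2`, `m₃(2/(α₀Q) + 10ε) ≤ 2θ`, then
  `Pr[A(H₀(Ψ̄_{ρ₀}, ζ))] - Pr[A(U)] ≥ 1 - (4(G+1)/(Nθ²) + 8/(N'θ²))` — the left-hand side of
  `LWE.blprs_theorem_4_1_bound` (`BLPRSThm41Skeleton.lean`) at modulus `Q`.

## References

* Z. Brakerski, A. Langlois, C. Peikert, O. Regev, D. Stehlé, *Classical hardness of learning with
  errors*, STOC 2013; arXiv:1306.0281, Cor. 3.2, Lemma 2.15, Def. 2.11/2.14 and p. 13. [BrakerskiEtAl2013]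
* O. Regev, *On lattices, learning with errors …*, J. ACM 56 (2009), Lemma 4.1 (proof: the shift
  `(a, b) ↦ (a, b + ⟨a,t⟩)`) and Lemma 4.3. [RegevLWE2009]
-/

noncomputable section

open MeasureTheory Literature.Algebra.EuclideanLattices Literature.Probability.Distributions
open scoped Real ENNReal

namespace Literature.Computability.Cryptography

namespace BLPRS2013

open LWE LWE.MP12

/-! ### The rows of the rate-guess test: shift the secret, switch the modulus with noise raising `τ w` -/

section Rows

variable (n Q q' : ℕ) [NeZero Q] [NeZero q'] (r B : ℝ) {G : ℕ} (τ : Fin G → ℝ) (m₃ : ℕ)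

/-- **Row `w` of the reduction**: a fresh uniform secret shift `t ← U(ℤ_{q'}ⁿ)`, then the discretised modulus
switch `Q → q'` with noise raising `τ w` on a block of `m₃` samples. [cite: BrakerskiEtAl2013, Cor. 3.2 with Lemma 2.15; RegevLWE2009, Lemma 4.1 (proof)] -/
def rateGuessKernel (w : Fin G) (S : Fin m₃ → (Fin n → ZMod Q) × ZMod Q) : PMF (Fin m₃ → (Fin n → ZMod q') × ZMod q') :=
  (PMF.uniformOfFintype (Fin n → ZMod q')).bind fun t => switchKernelPMF n Q q' r B (τ w) t m₃ S

variable {n Q q' r B τ m₃}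

/-- **One-pair advantage transfer through the switch**: if the outputs on `P` are `d`-close to `T`, the composed
test accepts `P` with probability `d`-close to `K`'s acceptance of `T`. [cite: BrakerskiEtAl2013, Cor. 3.2 (advantage form)] -/
theorem abs_toReal_acceptProb_switchTest_sub_le {τ₀ : ℝ} {t : Fin n → ZMod q'}
    (K : (Fin m₃ → (Fin n → ZMod q') × ZMod q') → PMF Bool) (P : PMF (Fin m₃ → (Fin n → ZMod Q) × ZMod Q))
    (T : PMF (Fin m₃ → (Fin n → ZMod q') × ZMod q')) {d : ℝ} (h : statDist (switchOutputs n Q q' r B τ₀ t m₃ P) T.toMeasure ≤ d) :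
    |(acceptProb (switchTest n Q q' r B τ₀ t m₃ K) P).toReal - (acceptProb K T).toReal| ≤ d := by
  have hf : Measurable fun T : Fin m₃ → (Fin n → ZMod q') × ZMod q' => (K T true : ℝ≥0∞) := measurable_of_countable _
  have hf1 : ∀ T : Fin m₃ → (Fin n → ZMod q') × ZMod q', (K T true : ℝ≥0∞) ≤ 1 := fun T => PMF.coe_le_one _ _
  rw [toReal_acceptProb_switchTest, toReal_acceptProb_eq_lintegral]
  exact (abs_toReal_lintegral_sub_le_statDist (switchOutputs n Q q' r B τ₀ t m₃ P) T.toMeasure hf hf1).trans h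

/-- For a fixed shift, the row's acceptance probability is the composed test's. [folklore] -/
theorem pacc_bind_switchKernelPMF {τ₀ : ℝ} (t : Fin n → ZMod q') (K : (Fin m₃ → (Fin n → ZMod q') × ZMod q') → PMF Bool)
    (P : PMF (Fin m₃ → (Fin n → ZMod Q) × ZMod Q)) :
    pacc K (P.bind (switchKernelPMF n Q q' r B τ₀ t m₃)) = (acceptProb (switchTest n Q q' r B τ₀ t m₃ K) P).toReal := by
  unfold pacc acceptProb switchTest
  rw [PMF.bind_bind]

/-- **The row acceptance probability is the average over the shift of the fixed-shift ones.** [folklore] -/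
theorem pacc_bind_rateGuessKernel (K : (Fin m₃ → (Fin n → ZMod q') × ZMod q') → PMF Bool) (P : PMF (Fin m₃ → (Fin n → ZMod Q) × ZMod Q))
    (w : Fin G) :
    pacc K (P.bind (rateGuessKernel n Q q' r B τ m₃ w)) =
      ∑ t : Fin n → ZMod q', ((PMF.uniformOfFintype (Fin n → ZMod q')) t).toReal *
        (acceptProb (switchTest n Q q' r B (τ w) t m₃ K) P).toReal := by
  unfold rateGuessKernel
  rw [PMF.bind_comm, pacc_bind_eq_sum]
  exact Finset.sum_congr rfl fun t _ => by rw [pacc_bind_switchKernelPMF]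

/-- **Uniform blocks mod `Q` go to (almost) uniform blocks mod `q'`**: in `K`-acceptance the row output of a uniform
block is within `4εm₃` of a uniform block mod `q'`. [cite: BrakerskiEtAl2013, Lemma 3.5 (i) / Cor. 3.2] -/
theorem abs_pacc_rateGuessKernel_uniform_sub_le {ε : ℝ} (hn : 0 < n) (hε : 0 < ε) (hε' : ε ≤ 1 / 2)
    (hr : max (Q : ℝ)⁻¹ (q' : ℝ)⁻¹ * Real.sqrt (2 * Real.log (2 * n * (1 + 1 / ε)) / π) ≤ r)
    (K : (Fin m₃ → (Fin n → ZMod q') × ZMod q') → PMF Bool) (w : Fin G) :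
    |pacc K ((uniformSamples (Fin n) (ZMod Q) m₃).bind (rateGuessKernel n Q q' r B τ m₃ w)) -
        pacc K (uniformSamples (Fin n) (ZMod q') m₃)| ≤ m₃ * (4 * ε) := by
  rw [pacc_bind_rateGuessKernel]
  refine abs_sum_toReal_mul_sub_const_le _ _ _ fun t => ?_
  exact abs_toReal_acceptProb_switchTest_sub_le K _ _ (statDist_switchOutputs_uniform_le hn hε hε' hr)

/-- **Averaging the shifted secret over a uniform shift gives the uniform-secret law**:
`E_{t ← U} A^m_{s+t,χ} = lweSamplesUniformSecret χ m`. [cite: RegevLWE2009, Lemma 4.1 (proof)] -/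
theorem bind_uniform_lweSamples_add (χ : PMF (ZMod q')) (s : Fin n → ZMod q') (m : ℕ) :
    ((PMF.uniformOfFintype (Fin n → ZMod q')).bind fun t => lweSamples χ (s + t) m) = lweSamplesUniformSecret χ m := by
  have hbij : Function.Bijective fun t : Fin n → ZMod q' => s + t :=
    ⟨fun a b h => add_left_cancel h, fun c => ⟨c - s, add_sub_cancel s c⟩⟩
  unfold lweSamplesUniformSecret
  conv_rhs => rw [← uniformOfFintype_map_of_bijective hbij, PMF.bind_map]
  rfl

/-- **`A_{z̄,Ψ̄_ρ}` blocks mod `Q` go to (almost) `LWE_{n,q',Ψ̄_{ρ'}}` blocks with a UNIFORM secret**,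
`ρ'² = ρ² + r²(‖z‖² + B²) + τ_w²`: in `K`-acceptance, within `m₃(2/(ρQ) + 10ε)`.
[cite: BrakerskiEtAl2013, Lemma 3.5 (ii) / Cor. 3.2 with Lemma 2.15; RegevLWE2009, Lemma 4.1 (proof)] -/
theorem abs_pacc_rateGuessKernel_lwe_sub_le {ε ρ : ℝ} (hn : 0 < n) (hε : 0 < ε) (hε' : ε ≤ 1 / 2)
    (hr : max (Q : ℝ)⁻¹ (q' : ℝ)⁻¹ * Real.sqrt (2 * Real.log (2 * n * (1 + 1 / ε)) / π) ≤ r) (hρ : 0 < ρ)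
    (z : Fin n → ℤ) (hzB : ‖intVecToEuclidean n z‖ ≤ B)
    (K : (Fin m₃ → (Fin n → ZMod q') × ZMod q') → PMF Bool) (w : Fin G) :
    |pacc K ((lweSamples (discretizedGaussian Q ρ) (intCastVec z : Fin n → ZMod Q) m₃).bind (rateGuessKernel n Q q' r B τ m₃ w)) -
        pacc K (lweSamplesUniformSecret
          (discretizedGaussian q' (Real.sqrt (Real.sqrt (ρ ^ 2 + r ^ 2 * (‖intVecToEuclidean n z‖ ^ 2 + B ^ 2)) ^ 2 + τ w ^ 2))) m₃)| ≤
      m₃ * (2 / (ρ * Q) + 10 * ε) := by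
  rw [pacc_bind_rateGuessKernel, ← bind_uniform_lweSamples_add _ (fun j => (z j : ZMod q')), pacc_bind_eq_sum]
  refine abs_sum_toReal_mul_sub_le _ _ _ fun t => ?_
  refine abs_toReal_acceptProb_switchTest_sub_le K _ _ ?_
  -- Cor. 3.2 at the point mass `ζ = δ_z`
  have h := statDist_switchOutputs_lwe_le (Q := Q) (q' := q') (r := r) (B := B) (τ := τ w) (t := t) (m := m₃) hn hε hε' hr hρ
    (PMF.pure z) (fun _ => ρ) (fun _ _ => le_rfl) (fun z' hz' => by
      rw [PMF.support_pure, Set.mem_singleton_iff] at hz'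
      rw [hz']; exact hzB)
  rw [lweMix, lweMix, PMF.pure_bind, PMF.pure_bind, add_zero] at h
  exact h

/-- **Data processing for a row**: replacing the block law moves the row acceptance probability by at most the
statistical distance of the block laws. [folklore] -/
theorem abs_pacc_bind_sub_le_tvDist {X Y : Type} (K : Y → PMF Bool) (κ : X → PMF Y) (P P' : PMF X) :
    |pacc K (P.bind κ) - pacc K (P'.bind κ)| ≤ P.tvDist P' := by
  have h := abs_acceptProb_toReal_sub_le_tvDist (fun S => (κ S).bind K) P P'
  unfold acceptProb at h
  unfold pacc
  rwa [PMF.bind_bind, PMF.bind_bind]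

end Rows

/-! ### The advantage of the rate-guess test against `binLWE` mod `Q` -/

section Advantage

variable {n Q q' : ℕ} [NeZero Q] [NeZero q'] {r B : ℝ} {G : ℕ} {τ : Fin G → ℝ} {m₃ N N' : ℕ} {θ : ℝ}

/-- **The test on `binLWE_{n,·,Q,≤}` built from a distinguisher `K` of `LWE_{n,q',Ψ̄_α}`** (Cor. 3.2 + secret
re-randomisation + Lemma 2.15's estimate-and-flag over the guesses `τ`): if `K` has advantage `≥ 4θ` against
`LWE_{n,q',Ψ̄_α}` with uniform secret on `m₃` samples, every secret `z` in the support of `ζ` has `‖z‖ ≤ B`, a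
noise law `χ₀(z̄)` within `η₀` of `Ψ̄_{ρ₀(z̄)}` with `ρ₀(z̄) ≥ α₀`, and a guess `w` whose switched-and-raised rate is
exactly `α`, and the per-block errors are small (`4εm₃ ≤ θ/2`, `m₃(2/(α₀Q) + 10ε) + m₃η₀ ≤ 2θ`), then the flat
rate-guess test `A` on `G·(N·m₃)` samples mod `Q` satisfies
`Pr[A(H₀(χ₀, ζ))] - Pr[A(U)] ≥ 1 - (4(G+1)/(Nθ²) + 8/(N'θ²))` — the left-hand side of `LWE.blprs_theorem_4_1_bound`
(there `χ₀` is compared with the first hybrid's noise `noiseH₁`, which `LWEBinaryNoiseInstantiation.lean` puts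
within `4ε` of `Ψ̄_{√(‖z̄‖²r_N² + γ²)}` for binary `z`; take `χ₀ := noiseH₁ …`, `η₀ := 4ε` there).
[cite: BrakerskiEtAl2013, p. 13 (Thm. 4.1 + Cor. 3.2 + Lemma 2.15); RegevLWE2009, Lemma 4.1] -/
theorem advantage_rateGuess_hybridH₀ {ε α α₀ η₀ : ℝ} (hn : 0 < n) (hε : 0 < ε) (hε' : ε ≤ 1 / 2)
    (hr : max (Q : ℝ)⁻¹ (q' : ℝ)⁻¹ * Real.sqrt (2 * Real.log (2 * n * (1 + 1 / ε)) / π) ≤ r) (hα₀ : 0 < α₀)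
    (hN : 0 < N) (hN' : 0 < N') (hθ : 0 < θ)
    (K : (Fin m₃ → (Fin n → ZMod q') × ZMod q') → PMF Bool) (hK : 4 * θ ≤ distinguishingAdvantage (discretizedGaussian q' α) m₃ K)
    (χ₀ : (Fin n → ZMod Q) → PMF (ZMod Q)) (ρ₀ : (Fin n → ZMod Q) → ℝ) (ζ : PMF (Fin n → ℤ))
    (hζ : ∀ z ∈ ζ.support, ‖intVecToEuclidean n z‖ ≤ B ∧ α₀ ≤ ρ₀ (intCastVec z) ∧
      (χ₀ (intCastVec z)).tvDist (discretizedGaussian Q (ρ₀ (intCastVec z))) ≤ η₀ ∧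
      ∃ w : Fin G, Real.sqrt (Real.sqrt (ρ₀ (intCastVec z) ^ 2 + r ^ 2 * (‖intVecToEuclidean n z‖ ^ 2 + B ^ 2)) ^ 2 + τ w ^ 2) = α)
    (hεθ : m₃ * (4 * ε) ≤ θ / 2) (hQθ : m₃ * (2 / (α₀ * Q) + 10 * ε) + m₃ * η₀ ≤ 2 * θ) :
    1 - ((G + 1) * (4 / (N * θ ^ 2)) + 8 / (N' * θ ^ 2)) ≤
      (acceptProb (flatGuessTest K N m₃ (rateGuessKernel n Q q' r B τ m₃) (uniformSamples (Fin n) (ZMod q') m₃) N' θ)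
          (hybridH₀ χ₀ (G * (N * m₃)) ζ)).toReal -
        (acceptProb (flatGuessTest K N m₃ (rateGuessKernel n Q q' r B τ m₃) (uniformSamples (Fin n) (ZMod q') m₃) N' θ)
          (uniformSamples (Fin n) (ZMod Q) (G * (N * m₃)))).toReal := by
  refine advantage_flatGuessTest_hybridH₀ K N (rateGuessKernel n Q q' r B τ m₃) (uniformSamples (Fin n) (ZMod q') m₃) N' θ
    χ₀ ζ hN hN' hθ (fun w => ?_) (fun z hz => ?_)
  · exact (abs_pacc_rateGuessKernel_uniform_sub_le hn hε hε' hr K w).trans hεθ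
  · obtain ⟨hzB, hρ, hχ, w, hw⟩ := hζ z hz
    refine ⟨w, ?_⟩
    have hρ0 : 0 < ρ₀ (intCastVec z) := hα₀.trans_le hρ
    -- the Gaussian row is close to `LWE_{n,q',Ψ̄_α}` with uniform secret …
    have hclose := abs_pacc_rateGuessKernel_lwe_sub_le (τ := τ) (m₃ := m₃) hn hε hε' hr hρ0 z hzB K w
    rw [hw] at hclose
    -- … the actual row is close to the Gaussian row …
    have hrow : |pacc K ((lweSamples (χ₀ (intCastVec z)) (intCastVec z : Fin n → ZMod Q) m₃).bind (rateGuessKernel n Q q' r B τ m₃ w)) -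
        pacc K ((lweSamples (discretizedGaussian Q (ρ₀ (intCastVec z))) (intCastVec z : Fin n → ZMod Q) m₃).bind
          (rateGuessKernel n Q q' r B τ m₃ w))| ≤ m₃ * η₀ :=
      (abs_pacc_bind_sub_le_tvDist K _ _ _).trans
        ((tvDist_lweSamples_le _ _ _ m₃).trans (mul_le_mul_of_nonneg_left hχ (Nat.cast_nonneg m₃)))
    -- … whose `K`-acceptance is `Adv[K] ≥ 4θ` away from uniform
    have hadv : 4 * θ ≤ |pacc K (lweSamplesUniformSecret (discretizedGaussian q' α) m₃) - pacc K (uniformSamples (Fin n) (ZMod q') m₃)| :=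
      hK
    have hQ : (0 : ℝ) < Q := by exact_mod_cast Nat.pos_of_ne_zero (NeZero.ne Q)
    have hd : (m₃ : ℝ) * (2 / (ρ₀ (intCastVec z) * Q) + 10 * ε) + m₃ * η₀ ≤ 2 * θ := by
      refine le_trans ?_ hQθ
      have : 2 / (ρ₀ (intCastVec z) * Q) ≤ 2 / (α₀ * Q) := by
        apply div_le_div_of_nonneg_left (by norm_num) (by positivity)
        exact mul_le_mul_of_nonneg_right hρ hQ.le
      nlinarith [Nat.cast_nonneg (α := ℝ) m₃]
    rw [abs_le] at hclose hrow
    rw [le_abs] at hadv ⊢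
    rcases hadv with h | h
    · left; linarith [hclose.1, hclose.2, hrow.1, hrow.2]
    · right; linarith [hclose.1, hclose.2, hrow.1, hrow.2]

end Advantage

end BLPRS2013

end Literature.Computability.Cryptography

end
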